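import Summits.FinalStateConjecture.FinalStateConjecture.Theorems.ZeroEnergyKerrOrBombStationaryLimitReductionKerrIsometryRigidityWave3Facts
import Summits.FinalStateConjecture.FinalStateConjecture.Theorems.ZeroEnergyKerrOrBombStationaryLimitReductionKerrIsometryRigidityWave3EndMatchingCore
import Summits.FinalStateConjecture.FinalStateConjecture.Theorems.ZeroEnergyKerrOrBombStationaryLimitReductionTimeEquivariantMaps
import Literature.Geometry.Lorentzian.KerrScriLeafGap
import Literature.Geometry.Lorentzian.KerrStarCoord
import Literature.Geometry.Lorentzian.KerrWaveEnergy
import HarnessLib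

/-!
# Route ZeroEnergyKerrOrBomb · crux `FinalStateFromKerrOrBomb` (stmt-FinalStateConjecture-17839), line
# `SketchIdeator1` — stub `stub_kerrAsymptoticRigidity` (F4 of stub 1R), layer 4: the Kerr–Schild radius and
# the adapted radius are COMPARABLE along the chart identification

Helper file (`--supports stmt-FinalStateConjecture-17839`; registered helper
`kerrAsymptoticRigidity_radius_comparable`) of the lead's wave-2 stub-worker for
`stub_kerrAsymptoticRigidity : SigM.stub_kerrAsymptoticRigidity` (`:= KerrAsymptoticRigidity`, obligation F4 of
stub 1R, `…KerrIsometryRigidityWave3Facts`). Hypotheses: the binder list of `KerrAsymptoticRigidity` VERBATIM,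
then the conclusions of layer 1 (`c = 1`, `kerrAsymptoticRigidity_c_eq_one`, p137926) and of layer 2 (two-sided
bounds `‖dΘ_u‖ ≤ L`, `‖v‖ ≤ L ‖dΘ_u v‖` on `{r ≥ R}`, `kerrAsymptoticRigidity_fderiv_bounded`, p137926).
Conclusion: far out `r(x) ≤ C · A.radius (Θ x)` and `A.radius (Θ x) ≤ C · r(x)` — the quantitative form of the
end-matching clause needed to convert the decay of `D(A.bilin)` at `A`-radius `→ ∞` into decay in `r`.

* §1 a first-exit lemma (`exists_exit_of_norm_fderiv_le`): along a segment in an open set on which `Φ` is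
  differentiable with `‖DΦ‖ ≤ L` as long as `ρ ∘ Φ > R`, either `ρ ∘ Φ ≤ R` is reached or the end of the
  segment is, within `Φ`-displacement `L ‖d‖` (closedness of the exit set, mean value inequality
  `norm_image_sub_le_of_norm_deriv_le_segment'`);
* §2 `r(x) ≤ C r_A(Θ x)`: apply §1 to the inverse chart map `Φ = Θ⁻¹` (`chartInv`, strictly differentiable on
  the open chart preimage `P = Θ(exterior)` of the d.o.c. with `DΦ = (dΘ)⁻¹`, `‖DΦ‖ ≤ L` where `r ∘ Φ ≥ R`;
  `…Wave3EndTopology`, `kerrCharted_isOpenEmbedding`) along the inward radial spatial segment from `u = Θ x`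
  to the cylinder `{‖y‖ = R₁} ⊆ P` (`mem_chartDoc_of_le_spatialNorm`): the spatial part of `Φ` moves by at
  most `L ‖u_{space}‖`, and at the exit/end point it is bounded (`‖y‖ ≤ r + |a|` where `r ≤ R`; on the
  cylinder by compactness of `{0} × {‖y‖ = R₁}` and time independence of `Φ_{space}`);
* §3 `r_A(Θ x) ≤ C r(x)`: the `(e₀, e₀)` component of the isometry with `c = 1` reads
  `2H(x) = A.bilin(Θ x)(e₀, e₀) + 1 = 2M_A/‖(Θ x)_{space}‖ + E₀₀(Θ x)` with `|E₀₀| ≤ C/r_A²`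
  (`ChartIsAsymptoticallySchwarzschildean'`, order `0`) and `H(x) ≥ M r/(r² + a²)` (`Kerr.div_le_scalarH`), `M > 0`.

Elementary; no named fact, nothing restated. References: P. T. Chruściel, J. L. Costa, arXiv:0806.0016, §2.1–2.2;
R. Bartnik, CPAM 39 (1986), §3, Cor. 3.2 (two-sided control of transition maps).
-/

set_option linter.dupNamespace false

-- instance search through the nested operator types `E4 →L[ℝ] E4 →L[ℝ] ℝ`
set_option maxSynthPendingDepth 3

noncomputable section

open scoped Manifold ContDiff Topology
open Set Filter Function

namespace Summit.FinalStateConjecture.FinalStateConjecture.Theorems.SymplecticDualOfTheBomb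

open Literature.Geometry.Lorentzian
open Summit.FinalStateConjecture.FinalStateConjecture.Theorems.OneLockedExplosion

/-! ## §1 A first-exit lemma along segments -/

/-- **First exit along a segment.** Let `P` be a set containing the segment `u + s d`, `s ∈ [0, 1]`, `Φ`
differentiable at the points of `P` with `‖DΦ(w)‖ ≤ L` whenever `ρ(Φ w) > R` (`ρ` continuous, `L ≥ 0`). Then
there is `s ∈ [0, 1]` with `ρ(Φ(u + s d)) ≤ R` or `s = 1`, and `‖Φ(u + s d) − Φ u‖ ≤ L ‖d‖` (take the first
`s` with `ρ ≤ R`, a closed condition, and apply the mean value inequality before it). [folklore] -/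
private theorem exists_exit_of_norm_fderiv_le {P : Set E4} {Φ : E4 → E4} {ρ : E4 → ℝ} (hρ : Continuous ρ)
    (hΦd : ∀ w ∈ P, DifferentiableAt ℝ Φ w) {R L : ℝ} (hL0 : 0 ≤ L)
    (hL : ∀ w ∈ P, R < ρ (Φ w) → ‖fderiv ℝ Φ w‖ ≤ L) {u d : E4}
    (hseg : ∀ s ∈ Icc (0 : ℝ) 1, u + s • d ∈ P) :
    ∃ s ∈ Icc (0 : ℝ) 1, (ρ (Φ (u + s • d)) ≤ R ∨ s = 1) ∧ ‖Φ (u + s • d) - Φ u‖ ≤ L * ‖d‖ := by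
  set g : ℝ → E4 := fun s ↦ Φ (u + s • d) with hg_def
  have hγ : ∀ s : ℝ, HasDerivAt (fun s : ℝ ↦ u + s • d) d s := fun s ↦ by
    simpa using ((hasDerivAt_id s).smul_const d).const_add u
  have hg : ∀ s ∈ Icc (0 : ℝ) 1, HasDerivAt g (fderiv ℝ Φ (u + s • d) d) s := fun s hs ↦
    ((hΦd _ (hseg s hs)).hasFDerivAt).comp_hasDerivAt s (hγ s)
  have hg0 : g 0 = Φ u := by simp [hg_def]
  -- mean value inequality on `[0, s₁]` when `ρ ∘ Φ > R` on `[0, s₁)`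
  have mvt : ∀ s₁ ∈ Icc (0 : ℝ) 1, (∀ s ∈ Ico (0 : ℝ) s₁, R < ρ (Φ (u + s • d))) →
      ‖Φ (u + s₁ • d) - Φ u‖ ≤ L * ‖d‖ := by
    intro s₁ hs₁ hfar
    have hsub : Icc 0 s₁ ⊆ Icc (0 : ℝ) 1 := Icc_subset_Icc le_rfl hs₁.2
    have h1 : ∀ s ∈ Icc (0 : ℝ) s₁, HasDerivWithinAt g (fderiv ℝ Φ (u + s • d) d) (Icc 0 s₁) s :=
      fun s hs ↦ (hg s (hsub hs)).hasDerivWithinAt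
    have h2 : ∀ s ∈ Ico (0 : ℝ) s₁, ‖fderiv ℝ Φ (u + s • d) d‖ ≤ L * ‖d‖ := fun s hs ↦
      (ContinuousLinearMap.le_opNorm _ _).trans
        (mul_le_mul_of_nonneg_right (hL _ (hseg s (hsub (Ico_subset_Icc_self hs))) (hfar s hs))
          (norm_nonneg _))
    have h := norm_image_sub_le_of_norm_deriv_le_segment' h1 h2 s₁ (right_mem_Icc.2 hs₁.1)
    rw [hg0, sub_zero] at h
    calc ‖Φ (u + s₁ • d) - Φ u‖ = ‖g s₁ - Φ u‖ := rfl
      _ ≤ L * ‖d‖ * s₁ := h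
      _ ≤ L * ‖d‖ * 1 := mul_le_mul_of_nonneg_left hs₁.2 (mul_nonneg hL0 (norm_nonneg d))
      _ = L * ‖d‖ := mul_one _
  set E : Set ℝ := {s | s ∈ Icc (0 : ℝ) 1 ∧ ρ (Φ (u + s • d)) ≤ R} with hE_def
  by_cases hE : E.Nonempty
  · have hgc : ContinuousOn g (Icc 0 1) := fun s hs ↦ (hg s hs).continuousAt.continuousWithinAt
    have hEc : IsClosed E :=
      (hρ.comp_continuousOn hgc).preimage_isClosed_of_isClosed isClosed_Icc isClosed_Iic
    have hEb : BddBelow E := ⟨0, fun s hs ↦ hs.1.1⟩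
    have hs₀E : sInf E ∈ E := hEc.csInf_mem hE hEb
    refine ⟨sInf E, hs₀E.1, Or.inl hs₀E.2, mvt _ hs₀E.1 fun s hs ↦ ?_⟩
    by_contra hnot
    have hsE : s ∈ E := ⟨⟨hs.1, hs.2.le.trans hs₀E.1.2⟩, not_lt.1 hnot⟩
    exact (not_le.2 hs.2) (csInf_le hEb hsE)
  · refine ⟨1, right_mem_Icc.2 zero_le_one, Or.inr rfl, mvt 1 (right_mem_Icc.2 zero_le_one) fun s hs ↦ ?_⟩
    by_contra hnot
    exact hE ⟨s, Ico_subset_Icc_self hs, not_lt.1 hnot⟩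

/-! ## §2–3 The two radii are comparable along `Θ` -/

/-- `‖e₀‖ = 1`. [folklore] -/
private theorem norm_basisVector_zero : ‖(E4.basisVector 0 : E4)‖ = 1 := by
  rw [E4.basisVector, PiLp.norm_single, norm_one]

/-- The Kerr exterior has points of arbitrarily large Kerr–Schild radius. [folklore] -/
private theorem exists_mem_exterior_le_radius (M a K : ℝ) :
    ∃ x ∈ (Kerr.exterior M a : Set E4), K ≤ Kerr.radius a x := by
  set K' : ℝ := max K (max (Kerr.rPlus M a) 0 + 1) with hK'
  have hK'0 : 0 ≤ K' := le_max_of_le_right (by positivity)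
  set y : E3 := EuclideanSpace.single 0 (K' + |a|) with hy
  have hyn : ‖y‖ = K' + |a| := by
    rw [hy, PiLp.norm_single, Real.norm_eq_abs, abs_of_nonneg (by positivity)]
  have h1 := Kerr.spatialNorm_sq_sub_sq_le_radius_sq a (E4.ofTimeSpace 0 y)
  rw [E4.spatialNorm_ofTimeSpace, hyn] at h1
  have h2 : K' ^ 2 ≤ Kerr.radius a (E4.ofTimeSpace 0 y) ^ 2 := by nlinarith [abs_nonneg a, sq_abs a]
  have h3 : K' ≤ Kerr.radius a (E4.ofTimeSpace 0 y) :=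
    (pow_le_pow_iff_left₀ hK'0 (Kerr.radius_nonneg _ _) two_ne_zero).1 h2
  refine ⟨E4.ofTimeSpace 0 y, ?_, (le_max_left _ _).trans h3⟩
  rw [SetLike.mem_coe, Kerr.mem_exterior]
  have : max (Kerr.rPlus M a) 0 + 1 ≤ K' := le_max_right _ _
  linarith

/-- For `a = 0`, `H = M/‖x_{space}‖` wherever `‖x_{space}‖ ≠ 0`. [folklore] -/
private theorem scalarH_zero_spin (M : ℝ) {x : E4} (hx : E4.spatialNorm x ≠ 0) :
    Kerr.scalarH M 0 x = M / E4.spatialNorm x := by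
  rw [Kerr.scalarH, Kerr.radius_zero_left]
  field_simp
  ring

/-- `‖x_{space}‖ ≤ r(x) + |a|` on `{r > 0}` (the tree's leaf form `Kerr.norm_le_radius_add_abs`). [folklore] -/
private theorem spatialNorm_le_radius_add {a : ℝ} {x : E4} (hx : 0 < Kerr.radius a x) :
    E4.spatialNorm x ≤ Kerr.radius a x + |a| := by
  have h := Kerr.norm_le_radius_add_abs (a := a) (y := E4.spatial x) (by rwa [Kerr.radius_ofTimeSpace_spatial])
  rwa [Kerr.radius_ofTimeSpace_spatial] at h

/-- `‖(0, y)‖ = ‖y‖`. [folklore] -/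
private theorem norm_ofTimeSpace_zero (y : E3) : ‖E4.ofTimeSpace 0 y‖ = ‖y‖ := by
  have h := E4.norm_sq_eq_time_sq_add (E4.ofTimeSpace 0 y)
  rw [E4.ofTimeSpace_apply_zero, E4.spatialNorm_ofTimeSpace] at h
  nlinarith [norm_nonneg (E4.ofTimeSpace 0 y), norm_nonneg y, sq_nonneg (‖E4.ofTimeSpace 0 y‖ - ‖y‖),
    sq_nonneg (‖E4.ofTimeSpace 0 y‖ + ‖y‖)]

/-- **Registered helper `kerrAsymptoticRigidity_radius_comparable`** (layer 4 of F4 = `KerrAsymptoticRigidity`; its binder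
list verbatim, followed by the conclusions `c = 1` of layer 1 and the two-sided bounds on `dΘ` of layer 2): far out along
the exterior, `r(x) ≤ C · A.radius (Θ x)` and `A.radius (Θ x) ≤ C · r(x)`. (i) For the first bound, follow the inward
radial SPATIAL segment from `u = Θ x` to the cylinder `{‖y‖ = R₁}` inside the chart preimage `P = Θ(exterior)` of the
d.o.c. (`mem_chartDoc_of_le_spatialNorm`), applying the first-exit lemma to `Φ = Θ⁻¹` (`chartInv`, differentiable on
the open `P` with `DΦ = (dΘ)⁻¹`, `…Wave3EndTopology`; `‖DΦ‖ ≤ L` where `r ∘ Φ ≥ R` by layer 2): the spatial part of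
`Φ` moves by at most `L ‖u_{space}‖`, and is bounded at the exit point (`‖y‖ ≤ r + |a|`, `r ≤ R`) or at the end
point (compact slice of the cylinder, `Φ_{space}` time independent by `T`-equivariance). (ii) For the second, the
`(e₀, e₀)` component of the isometry (`dΘ e₀ = e₀` as `c = 1`) reads `2H(x) = A.bilin(Θ x)(e₀, e₀) + 1 =
2M_A/‖(Θ x)_{space}‖ + E₀₀` with `|E₀₀| ≤ C/r_A²` (order `0` of `ChartIsAsymptoticallySchwarzschildean'`), while
`H(x) ≥ M r/(r² + a²)`, `M > 0` (`Kerr.div_le_scalarH`). Chruściel–Costa arXiv:0806.0016, §2.1–2.2; Bartnik 1986,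
§3, Cor. 3.2. [folklore] -/
theorem kerrAsymptoticRigidity_radius_comparable : ∀ (𝓑 : StationaryAFBlackHole.{0}) (A : 𝓑.AdaptedChart) (M a c : ℝ) (Θ : E4 → E4), ChartIsAsymptoticallyCartesian A → ChartIsAsymptoticallySchwarzschildean' A → Kerr.IsSubextremal M a → 0 < c → ContDiffOn ℝ ∞ Θ (Kerr.exterior M a : Set E4) → Set.InjOn Θ (Kerr.exterior M a : Set E4) → Set.MapsTo Θ (Kerr.exterior M a : Set E4) (A.domain : Set E4) → (∀ x ∈ (Kerr.exterior M a : Set E4), ∀ s : ℝ, Θ (x + s • E4.basisVector 0) = Θ x + (c * s) • E4.basisVector 0) → (∀ x ∈ (Kerr.exterior M a : Set E4), ∀ v w : E4, A.bilin (Θ x) (fderiv ℝ Θ x v) (fderiv ℝ Θ x w) = Kerr.bilin M a x v w) → Θ '' (Kerr.exterior M a : Set E4) = {u : E4 | ∃ h : u ∈ A.domain, A.toFun ⟨u, h⟩ ∈ 𝓑.doc} → (∀ R₁ : ℝ, ∃ R : ℝ, ∀ x ∈ (Kerr.exterior M a : Set E4), R ≤ Kerr.radius a x → R₁ ≤ A.radius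 (Θ x)) → c = 1 → ∀ R L : ℝ, (∀ u ∈ (Kerr.exterior M a : Set E4), R ≤ Kerr.radius a u → ‖fderiv ℝ Θ u‖ ≤ L ∧ ∀ v : E4, ‖v‖ ≤ L * ‖fderiv ℝ Θ u v‖) → ∃ R' C : ℝ, ∀ x ∈ (Kerr.exterior M a : Set E4), R' ≤ Kerr.radius a x → Kerr.radius a x ≤ C * A.radius (Θ x) ∧ A.radius (Θ x) ≤ C * Kerr.radius a x := by
  intro 𝓑 A M a c Θ hcart hschw hMa hc hΘs hΘinj hΘmaps hΘT hΘiso hΘimg hfar hc1 R L hRL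
  subst hc1
  set S : Set E4 := (Kerr.exterior M a : Set E4) with hS_def
  have hSo : IsOpen S := (Kerr.exterior M a).isOpen
  have hM : 0 < M := hMa.pos
  have hSinv : ∀ x ∈ S, ∀ s : ℝ, x + s • E4.basisVector 0 ∈ S := kerrRegion_add_smul_mem a _
  obtain ⟨CA0, hCA0⟩ := A.exists_abs_radius_sub_spatialNorm_le
  have hL0 : 0 ≤ L := by
    obtain ⟨x, hx, hxR⟩ := exists_mem_exterior_le_radius M a R
    exact (norm_nonneg _).trans (hRL x hx hxR).1
  /- (i) the inverse chart map along inward radial segments -/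
  set P : Set E4 := Θ '' S with hP_def
  have hPo : IsOpen P :=
    (kerrCharted_isOpenEmbedding 𝓑 A M a (Kerr.rPlus M a) Θ le_rfl hΘs hΘinj hΘiso).2
  have hB₂ : ∀ x ∈ S, ∀ v : E4, (∀ w, Kerr.bilin M a x v w = 0) → v = 0 := fun x hx v hv ↦
    Kerr.bilin_nondegenerate M a (Kerr.radius_pos_of_mem_region hx) v hv
  set Φ : E4 → E4 := chartInv Θ S with hΦ_def
  have hΦS : ∀ u ∈ P, Φ u ∈ S ∧ Θ (Φ u) = u := fun u hu ↦ chartInv_spec hu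
  have hΦd : ∀ u ∈ P, DifferentiableAt ℝ Φ u ∧ (R < Kerr.radius a (Φ u) → ‖fderiv ℝ Φ u‖ ≤ L) := by
    intro u hu
    obtain ⟨hxS, hxu⟩ := hΦS u hu
    obtain ⟨Lx, hLv, hLx⟩ := exists_hasStrictFDerivAt_chartInv hSo hΘs hΘinj hΘiso hB₂ hxS
    rw [hxu] at hLx
    refine ⟨hLx.hasFDerivAt.differentiableAt, fun hR ↦ ?_⟩
    rw [hLx.hasFDerivAt.fderiv]
    refine ContinuousLinearMap.opNorm_le_bound _ hL0 fun q ↦ ?_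
    have h := (hRL _ hxS hR.le).2 ((Lx.symm : E4 →L[ℝ] E4) q)
    rwa [← hLv, ContinuousLinearEquiv.coe_coe, ContinuousLinearEquiv.apply_symm_apply] at h
  have hΦc : ContinuousOn Φ P := fun u hu ↦ (hΦd u hu).1.continuousAt.continuousWithinAt
  -- spatial part of `Φ` is time independent
  have hΦsp : ∀ u ∈ P, ∀ s : ℝ, E4.spatial (Φ (u + s • E4.basisVector 0)) = E4.spatial (Φ u) := by
    intro u hu s
    obtain ⟨hxS, hxu⟩ := hΦS u hu
    have h1 : Θ (Φ u + s • E4.basisVector 0) = u + s • E4.basisVector 0 := by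
      rw [hΘT _ hxS s, hxu, one_mul]
    rw [← h1, hΦ_def, chartInv_apply hΘinj (hSinv _ hxS s), Kerr.spatial_add_smul_basisVector_zero]
  -- the far cylinder lies in `P`
  obtain ⟨R₁', hR₁'⟩ := mem_chartDoc_of_le_spatialNorm A hschw
  set R₁ : ℝ := max R₁' 1 with hR₁_def
  have hR₁0 : 0 < R₁ := lt_of_lt_of_le one_pos (le_max_right _ _)
  have hcyl : ∀ u : E4, R₁ ≤ E4.spatialNorm u → u ∈ P := fun u hu ↦ by
    rw [hΘimg]; exact hR₁' u ((le_max_left _ _).trans hu)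
  -- bound of `Φ_{space}` on the compact slice `{0} × {‖y‖ = R₁}` of the cylinder
  set K : Set E4 := {w : E4 | w 0 = 0 ∧ E4.spatialNorm w = R₁} with hK_def
  have hKP : K ⊆ P := fun w hw ↦ hcyl w hw.2.ge
  have hKc : IsCompact K := by
    have hclosed : IsClosed K :=
      (isClosed_eq (PiLp.continuous_apply 2 _ 0) continuous_const).inter
        (isClosed_eq E4.continuous_spatialNorm continuous_const)
    refine Metric.isCompact_of_isClosed_isBounded hclosed ?_
    refine (Metric.isBounded_closedBall (x := (0 : E4)) (r := R₁)).subset fun w hw ↦ ?_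
    rw [Metric.mem_closedBall, dist_zero_right]
    have h := E4.norm_sq_eq_time_sq_add w
    rw [hw.1, hw.2] at h
    nlinarith [norm_nonneg w, hR₁0]
  obtain ⟨BK, hBK⟩ := hKc.exists_bound_of_continuousOn
    ((E4.continuous_spatialNorm.comp_continuousOn hΦc).mono hKP)
  -- (i) the bound `‖x_{space}‖ ≤ C₀ + L ‖(Θ x)_{space}‖` when `‖(Θ x)_{space}‖ ≥ R₁`
  set C₀ : ℝ := max (R + |a|) BK with hC₀_def
  have partA : ∀ x ∈ S, R₁ ≤ E4.spatialNorm (Θ x) → E4.spatialNorm x ≤ C₀ + L * E4.spatialNorm (Θ x) := by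
    intro x hx hσ
    set u : E4 := Θ x with hu_def
    have huP : u ∈ P := ⟨x, hx, rfl⟩
    have hΦu : Φ u = x := chartInv_apply hΘinj hx
    set σ : ℝ := E4.spatialNorm u with hσ_def
    have hσ0 : 0 < σ := hR₁0.trans_le hσ
    set p : E4 := E4.ofTimeSpace 0 (E4.spatial u) with hp_def
    have hpn : ‖p‖ = σ := by rw [hp_def, norm_ofTimeSpace_zero]; rfl
    set d : E4 := (R₁ / σ - 1) • p with hd_def
    have hk : 0 ≤ 1 - R₁ / σ := by rw [sub_nonneg, div_le_one hσ0]; exact hσ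
    have hdn : ‖d‖ ≤ σ := by
      rw [hd_def, norm_smul, hpn, Real.norm_eq_abs, show R₁ / σ - 1 = -(1 - R₁ / σ) by ring, abs_neg,
        abs_of_nonneg hk]
      have : 1 - R₁ / σ ≤ 1 := by linarith [div_nonneg hR₁0.le hσ0.le]
      nlinarith
    have hsp : ∀ s : ℝ, E4.spatial (u + s • d) = (1 + s * (R₁ / σ - 1)) • E4.spatial u := by
      intro s
      rw [map_add, map_smul, hd_def, map_smul, hp_def, E4.spatial_ofTimeSpace, smul_smul, add_smul, one_smul]
    have hspn : ∀ s ∈ Icc (0 : ℝ) 1, E4.spatialNorm (u + s • d) = σ - s * (σ - R₁) := by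
      intro s hs
      have h1 : 0 ≤ 1 + s * (R₁ / σ - 1) := by
        have e1 : s * (1 - R₁ / σ) ≤ 1 * (1 - R₁ / σ) := mul_le_mul_of_nonneg_right hs.2 hk
        have e2 : 0 ≤ R₁ / σ := div_nonneg hR₁0.le hσ0.le
        nlinarith
      rw [E4.spatialNorm, hsp s, norm_smul, Real.norm_eq_abs, abs_of_nonneg h1]
      change (1 + s * (R₁ / σ - 1)) * σ = σ - s * (σ - R₁)
      field_simp
      ring
    have hseg : ∀ s ∈ Icc (0 : ℝ) 1, u + s • d ∈ P := fun s hs ↦ hcyl _ (by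
      rw [hspn s hs]; nlinarith [hs.1, hs.2, hσ])
    obtain ⟨s, hs, hexit, hdist⟩ := exists_exit_of_norm_fderiv_le (Kerr.continuous_radius a)
      (fun w hw ↦ (hΦd w hw).1) hL0 (fun w hw hRw ↦ (hΦd w hw).2 hRw) hseg
    set w : E4 := u + s • d with hw_def
    have hwP : w ∈ P := hseg s hs
    have hyS : Φ w ∈ S := (hΦS w hwP).1
    have hy : E4.spatialNorm (Φ w) ≤ C₀ := by
      rcases hexit with hr | rfl
      · have hr0 : 0 < Kerr.radius a (Φ w) := Kerr.radius_pos_of_mem_region hyS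
        exact ((spatialNorm_le_radius_add hr0).trans (by linarith)).trans (le_max_left _ _)
      · -- end point on the cylinder: reduce to the slice `{t = 0}`
        have hwn : E4.spatialNorm w = R₁ := by rw [hw_def, hspn 1 hs]; ring
        set w' : E4 := E4.ofTimeSpace 0 (E4.spatial w) with hw'_def
        have hw'K : w' ∈ K := ⟨rfl, by rw [hw'_def, E4.spatialNorm_ofTimeSpace]; exact hwn⟩
        have hww' : w = w' + E4.time w • E4.basisVector 0 := (ofTimeSpace_zero_spatial_add_time_smul w).symm
        have h1 : E4.spatial (Φ w) = E4.spatial (Φ w') := by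
          conv_lhs => rw [hww']
          exact hΦsp w' (hKP hw'K) _
        have h2 := hBK w' hw'K
        rw [Function.comp_apply, Real.norm_eq_abs, abs_of_nonneg (E4.spatialNorm_nonneg _)] at h2
        calc E4.spatialNorm (Φ w) = E4.spatialNorm (Φ w') := by rw [E4.spatialNorm, E4.spatialNorm, h1]
          _ ≤ BK := h2
          _ ≤ C₀ := le_max_right _ _
    have h3 := E4.abs_spatialNorm_sub_le x (Φ w)
    have h4 : ‖x - Φ w‖ ≤ L * σ := by
      rw [norm_sub_rev]
      have h5 := hdist
      rw [hΦu] at h5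
      exact h5.trans (mul_le_mul_of_nonneg_left hdn hL0)
    linarith [(abs_le.1 h3).2]
  /- (ii) the `(e₀, e₀)` component -/
  obtain ⟨MA, CA, RA, -, hder⟩ := hschw
  have partB : ∀ x ∈ S, RA ≤ A.radius (Θ x) → 1 ≤ A.radius (Θ x) → 2 * CA0 ≤ A.radius (Θ x) →
      |a| ≤ Kerr.radius a x → A.radius (Θ x) * M ≤ (|CA| + 4 * |MA|) * Kerr.radius a x := by
    intro x hx hRA h1 h2 ha
    have hr : 0 < Kerr.radius a x := Kerr.radius_pos_of_mem_region hx
    set rA : ℝ := A.radius (Θ x) with hrA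
    set σ : ℝ := E4.spatialNorm (Θ x) with hσ
    have hσA : rA / 2 ≤ σ := by
      have := hCA0 (Θ x)
      rw [← hrA, ← hσ] at this
      linarith [(abs_le.1 this).2, abs_nonneg (A.radius (Θ x) - E4.spatialNorm (Θ x)), le_abs_self CA0,
        (abs_le.1 this).1, neg_abs_le CA0]
    have hσ0 : 0 < σ := by linarith
    -- the isometry at `(e₀, e₀)`
    have he₀ : fderiv ℝ Θ x (E4.basisVector 0) = (1 : ℝ) • E4.basisVector 0 :=
      fderiv_apply_basisVector_zero_of_contDiffOn hSo (by simp) hΘs hΘT hx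
    rw [one_smul] at he₀
    have hiso := hΘiso x hx (E4.basisVector 0) (E4.basisVector 0)
    rw [he₀, Kerr.bilin_basisVector_zero_basisVector_zero] at hiso
    -- order-zero closeness to Schwarzschild
    have h0 := hder ⟨Θ x, hΘmaps hx⟩ hRA 0 (by norm_num)
    rw [norm_iteratedFDeriv_zero] at h0
    simp only [zero_add] at h0
    have hcomp := (A.bilin (Θ x) - Kerr.bilin MA 0 (Θ x)).le_opNorm₂ (E4.basisVector 0) (E4.basisVector 0)
    rw [sub_apply, sub_apply, norm_basisVector_zero, mul_one, mul_one, Real.norm_eq_abs, hiso,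
      Kerr.bilin_basisVector_zero_basisVector_zero, scalarH_zero_spin MA hσ0.ne'] at hcomp
    -- `hcomp : |(-1 + 2H) - (-1 + 2 (MA/σ))| ≤ ‖A − K₀‖ ≤ CA / rA²`
    have hH : M * Kerr.radius a x / (Kerr.radius a x ^ 2 + a ^ 2) ≤ Kerr.scalarH M a x :=
      Kerr.div_le_scalarH hM.le hr
    have hH2 : M / (2 * Kerr.radius a x) ≤ Kerr.scalarH M a x := by
      refine le_trans ?_ hH
      rw [div_le_div_iff₀ (by positivity) (by positivity)]
      have : a ^ 2 ≤ Kerr.radius a x ^ 2 := by rw [← sq_abs a]; exact pow_le_pow_left₀ (abs_nonneg a) ha 2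
      nlinarith
    have hup : 2 * Kerr.scalarH M a x ≤ (|CA| + 4 * |MA|) / rA := by
      have e1 : 2 * Kerr.scalarH M a x = ((-1 + 2 * Kerr.scalarH M a x) - (-1 + 2 * (MA / σ))) + 2 * (MA / σ) := by
        ring
      rw [e1]
      have t1 : (-1 + 2 * Kerr.scalarH M a x) - (-1 + 2 * (MA / σ)) ≤ |CA| / rA := by
        refine (le_abs_self _).trans (hcomp.trans (h0.trans ?_))
        calc CA / rA ^ 2 ≤ |CA| / rA ^ 2 := by gcongr; exact le_abs_self _
          _ ≤ |CA| / rA := by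
              apply div_le_div_of_nonneg_left (abs_nonneg _) (by positivity)
              nlinarith
      have t2 : 2 * (MA / σ) ≤ 4 * |MA| / rA := by
        calc 2 * (MA / σ) ≤ 2 * (|MA| / σ) := by gcongr; exact le_abs_self _
          _ ≤ 2 * (|MA| / (rA / 2)) := by gcongr
          _ = 4 * |MA| / rA := by field_simp; ring
      calc _ ≤ |CA| / rA + 4 * |MA| / rA := add_le_add t1 t2
        _ = (|CA| + 4 * |MA|) / rA := by ring
    have key : M / (2 * Kerr.radius a x) ≤ (|CA| + 4 * |MA|) / rA / 2 := by linarith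
    rw [div_le_iff₀ (by positivity), div_div, div_mul_eq_mul_div, le_div_iff₀ (by positivity)] at key
    linarith
  /- assembly -/
  obtain ⟨R₂, hR₂⟩ := hfar (max (max RA 1) (max (2 * CA0) (R₁ + CA0)))
  set C : ℝ := max (max C₀ 0 + L * |CA0| + L) ((|CA| + 4 * |MA|) / M) with hC_def
  refine ⟨max R₂ |a|, C, fun x hx hxR ↦ ?_⟩
  have hr : 0 < Kerr.radius a x := Kerr.radius_pos_of_mem_region hx
  have hfarx := hR₂ x hx ((le_max_left _ _).trans hxR)
  have hRA : RA ≤ A.radius (Θ x) := ((le_max_left _ _).trans (le_max_left _ _)).trans hfarx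
  have h1 : 1 ≤ A.radius (Θ x) := ((le_max_right _ _).trans (le_max_left _ _)).trans hfarx
  have h2 : 2 * CA0 ≤ A.radius (Θ x) := ((le_max_left _ _).trans (le_max_right _ _)).trans hfarx
  have h3 : R₁ + CA0 ≤ A.radius (Θ x) := ((le_max_right _ _).trans (le_max_right _ _)).trans hfarx
  have ha : |a| ≤ Kerr.radius a x := (le_max_right _ _).trans hxR
  constructor
  · -- `r ≤ C r_A`
    have hσ : R₁ ≤ E4.spatialNorm (Θ x) := by
      have := hCA0 (Θ x)
      linarith [(abs_le.1 this).2]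
    have hA := partA x hx hσ
    have hσ' : E4.spatialNorm (Θ x) ≤ A.radius (Θ x) + |CA0| := by
      have := hCA0 (Θ x)
      linarith [(abs_le.1 this).1, le_abs_self CA0]
    calc Kerr.radius a x ≤ E4.spatialNorm x := Kerr.radius_le_spatialNorm a x
      _ ≤ C₀ + L * E4.spatialNorm (Θ x) := hA
      _ ≤ max C₀ 0 + L * (A.radius (Θ x) + |CA0|) := by gcongr; exact le_max_left _ _
      _ = (max C₀ 0 + L * |CA0|) + L * A.radius (Θ x) := by ring
      _ ≤ (max C₀ 0 + L * |CA0|) * A.radius (Θ x) + L * A.radius (Θ x) := by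
          gcongr
          exact le_mul_of_one_le_right (by positivity) h1
      _ = (max C₀ 0 + L * |CA0| + L) * A.radius (Θ x) := by ring
      _ ≤ C * A.radius (Θ x) := by gcongr; exact le_max_left _ _
  · -- `r_A ≤ C r`
    have hB := partB x hx hRA h1 h2 ha
    calc A.radius (Θ x) = A.radius (Θ x) * M / M := by field_simp
      _ ≤ (|CA| + 4 * |MA|) * Kerr.radius a x / M := by gcongr
      _ = (|CA| + 4 * |MA|) / M * Kerr.radius a x := by ring
      _ ≤ C * Kerr.radius a x := by gcongr; exact le_max_right _ _

end Summit.FinalStateConjecture.FinalStateConjecture.Theorems.SymplecticDualOfTheBomb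

end
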